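import Summits.Ventures.YMGap.RobustBall.TorusRowsSU2Star
import Summits.Ventures.YMGap.RobustBall.TorusRowsSU3
import Summits.Ventures.YMGap.Thresholds.OneLinkEigenModulus
import HarnessLib

/-!
# Venture YMGap, track ROBUST-BALL (Y2) — crux Y2-X2 for the FULL tier-1 ball, step 7: HYPOTHESIS-FREE `SU(N)` /
# `SU(3)` rows of the robust vertex-star door on p2's first-order EIGEN modulus

HONEST FRAMING. WHAT THIS IS: a venture file (cell `pub-ymgap`, track Y2 ROBUST-BALL, seat ds-2): the robust star
door `RobustStarDoor` fed with the tree's HYPOTHESIS-FREE one-link modulus of p2,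
`OneLinkEigen.oneLinkKRModulus_eigen : OneLinkKRModulus N R (N²/(N²−1) · (1/2 + 2R)/(1/2 − R))` (`N ≥ 2`, `R < 1/2`),
at tree coupling `β_W/N` (`|β|/N = β_W/N²`, radius `R = 2(d−1) β_W/N²`): schemas for every `N ≥ 2` (`d = 4` torus
clustering up to `β_W/N`; `d = 3` Y4's `ClusterDomainClustering`) and NAMED `SU(3)` ROWS, all CLASS K WITHOUT the
cell's certified constants H1/H2 (`√3 ≤ 1.73206`, `e^{2ε}` by `Real.exp_bound'`, exact rationals, Neumann depth 20):
`d = 4` (β_W, ε): (1/8, .148) (1/6, .104) (1/5, .069) (1/4, .019) — today every `SU(3)` TORUS row of the cell is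
conditional on H1/H2, and the hypothesis-free single-link door with this modulus closes at `2K₁β_W < 1` (β_W ≈ 0.21);
`d = 3`: (1/4, .106) (3/10, .072) (1/3, .050) — a hypothesis-free `SU(3)` input for the §Y4 sentence (`BalabanSU3`
takes the conditional (1/4, .230) row today). WHAT THIS IS NOT: radii are door artefacts; nothing about the continuum
limit or the Millennium problem.

## References
* The tree: `RobustStarDoor.lean`, `TorusRowsSU2Star.lean` (this seat), `Thresholds/OneLinkEigenModulus.lean` (p2),
  `Thresholds/StarResolventDim.lean` (`gaugeR`, `doorPoly`), `TorusRowsSU3.lean` (`sqrt_three_le`).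
-/

noncomputable section

open Finset
open Literature.MathematicalPhysics.QuantumLattice (fundamentalRep)
open Literature.MathematicalPhysics.QuantumFieldTheory hiding ZdEdge
open Literature.MathematicalPhysics.QuantumFieldTheory.Balaban1983to89.StrongCouplingTorusWindow
open Literature.MathematicalPhysics.QuantumFieldTheory.Balaban1983to89.StrongCouplingDobrushinWindow
  (OneLinkKRModulus)
open Summit.Ventures.YMGap.StarResolventDim (Delta gaugeR doorPoly Delta_pos_of_door gaugeR_lt_one_of_door)

namespace Summit.Ventures.YMGap.RobustBall

/-! ### Decimal majorants (`sqrt_three_le : √3 ≤ 1.73206` is the tree's, `TorusRowsSU3`) -/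

/-- `e^{26 / 125} ≤ 615607 / 500000` (Mathlib's `Real.exp_bound'`, five terms). [folklore] -/
theorem exp_le_26_125_star3 : Real.exp (26 / 125) ≤ 615607 / 500000 := by
  have h := Real.exp_bound' (x := 26 / 125) (by norm_num) (by norm_num) (n := 5) (by norm_num)
  refine h.trans ?_
  simp only [Finset.sum_range_succ, Finset.sum_range_zero, Nat.factorial]
  norm_num

/-- `e^{69 / 500} ≤ 143497 / 125000` (Mathlib's `Real.exp_bound'`, five terms). [folklore] -/
theorem exp_le_69_500_star3 : Real.exp (69 / 500) ≤ 143497 / 125000 := by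
  have h := Real.exp_bound' (x := 69 / 500) (by norm_num) (by norm_num) (n := 5) (by norm_num)
  refine h.trans ?_
  simp only [Finset.sum_range_succ, Finset.sum_range_zero, Nat.factorial]
  norm_num

/-- `e^{19 / 500} ≤ 259683 / 250000` (Mathlib's `Real.exp_bound'`, five terms). [folklore] -/
theorem exp_le_19_500_star3 : Real.exp (19 / 500) ≤ 259683 / 250000 := by
  have h := Real.exp_bound' (x := 19 / 500) (by norm_num) (by norm_num) (n := 5) (by norm_num)
  refine h.trans ?_
  simp only [Finset.sum_range_succ, Finset.sum_range_zero, Nat.factorial]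
  norm_num

/-- `e^{53 / 250} ≤ 1236149 / 1000000` (Mathlib's `Real.exp_bound'`, five terms). [folklore] -/
theorem exp_le_53_250_star3 : Real.exp (53 / 250) ≤ 1236149 / 1000000 := by
  have h := Real.exp_bound' (x := 53 / 250) (by norm_num) (by norm_num) (n := 5) (by norm_num)
  refine h.trans ?_
  simp only [Finset.sum_range_succ, Finset.sum_range_zero, Nat.factorial]
  norm_num

/-- `e^{18 / 125} ≤ 230977 / 200000` (Mathlib's `Real.exp_bound'`, five terms). [folklore] -/
theorem exp_le_18_125_star3 : Real.exp (18 / 125) ≤ 230977 / 200000 := by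
  have h := Real.exp_bound' (x := 18 / 125) (by norm_num) (by norm_num) (n := 5) (by norm_num)
  refine h.trans ?_
  simp only [Finset.sum_range_succ, Finset.sum_range_zero, Nat.factorial]
  norm_num


/-! ### The schemas: every `N ≥ 2` on the eigen modulus through the robust star door -/

/-- **SCHEMA, `SU(N)` (`N ≥ 2`), `d = 4`, HYPOTHESIS-FREE**: torus clustering on the whole tier-1 ball
`ClusterDomainFR ε₀ ε₁ r` up to tree coupling `β_W/N` through the ROBUST STAR DOOR on p2's eigen modulus at radius
`R = 6β_W/N² < 1/2`: given majorants `e^{ε₀} ≤ E`, `√N ≤ S`, `N²/(N²−1)·(1/2+2R)/(1/2−R) ≤ Kb`, a coefficient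
`c ≥ Kb·E·(1+2Sε₁)·β_W/N²`, `λ ≥ Sε₁` and the three rational door inequalities, there are `A`, `m > 0` with
`TorusClusteringOnBallUpTo N 4 (β_W/N) ε₀ ε₁ r A m`. [folklore] -/
theorem suN_torusClusteringOnBallUpTo_star_eigen (Kn : ℕ) {N : ℕ} (hN : 2 ≤ N) {βW ε₀ ε₁ c lam E S Kb : ℝ}
    (hβ0 : 0 < βW) (hR : βW / (N : ℝ) ^ 2 * 6 < 1 / 2) (hε₁ : 0 ≤ ε₁) (hE : Real.exp ε₀ ≤ E)
    (hS : Real.sqrt N ≤ S) (hKb : (N : ℝ) ^ 2 / ((N : ℝ) ^ 2 - 1) * ((1 / 2 + 2 * (βW / (N : ℝ) ^ 2 * 6)) /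
      (1 / 2 - βW / (N : ℝ) ^ 2 * 6)) ≤ Kb)
    (hc : Kb * E * (1 + 2 * S * ε₁) * (βW / (N : ℝ) ^ 2) ≤ c) (hlam : S * ε₁ ≤ lam) (hθ1 : 6 * c + lam < 1)
    (hcd : doorPoly 4 c < 1) (hρ1 : gaugeR 4 c + (lam + (6 * c + lam) ^ Kn * (16 * lam)) / (1 - (6 * c + lam)) < 1)
    (r : ℕ) : ∃ A m : ℝ, 0 < m ∧ TorusClusteringOnBallUpTo N 4 (βW / N) ε₀ ε₁ r A m := by
  have hN1 : 1 ≤ N := by omega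
  have hNpos : (0 : ℝ) < N := by exact_mod_cast (show 0 < N by omega)
  have hN2 : (2 : ℝ) ≤ N := by exact_mod_cast hN
  set R : ℝ := βW / (N : ℝ) ^ 2 * 6 with hRdef
  have hR0 : 0 ≤ R := by positivity
  set K : ℝ := (N : ℝ) ^ 2 / ((N : ℝ) ^ 2 - 1) * ((1 / 2 + 2 * R) / (1 / 2 - R)) with hKdef
  have hmod : OneLinkKRModulus N R K := OneLinkEigen.oneLinkKRModulus_eigen hN hR
  have hK0 : 0 ≤ K := by
    have h1 : (0 : ℝ) < (N : ℝ) ^ 2 - 1 := by nlinarith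
    have h2 : (0 : ℝ) < 1 / 2 - R := by linarith
    positivity
  have hS0 : 0 ≤ S := (Real.sqrt_nonneg _).trans hS
  have hE0 : 0 ≤ E := (Real.exp_pos _).le.trans hE
  have hKb0 : 0 ≤ Kb := hK0.trans hKb
  have hc0 : 0 ≤ c := le_trans (by positivity) hc
  have hlam0 : 0 ≤ lam := le_trans (by positivity) hlam
  set θ : ℝ := 6 * c + lam with hθ
  set ρ : ℝ := gaugeR 4 c + (lam + θ ^ Kn * (16 * lam)) / (1 - θ) with hρ
  have hθ0 : 0 ≤ θ := by positivity
  have hgR := gaugeR_lt_one_of_door (d := 4) (by norm_num) hc0 hcd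
  have hρ0 : 0 ≤ ρ := by
    have : 0 ≤ θ ^ Kn := pow_nonneg hθ0 Kn
    have h1 : 0 < 1 - θ := by linarith
    rw [hρ]; exact add_nonneg hgR.1 (div_nonneg (by positivity) h1.le)
  have hβN : βW / (N : ℝ) / (N : ℝ) = βW / (N : ℝ) ^ 2 := by rw [div_div, sq]
  have hR' : βW / (N : ℝ) / (N : ℝ) * (2 * (((4 : ℕ) : ℝ) - 1)) ≤ R := by rw [hβN, hRdef]; norm_num
  have hc' : K * Real.exp ε₀ * (1 + 2 * Real.sqrt N * ε₁) * (βW / (N : ℝ) / (N : ℝ)) ≤ c := by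
    refine le_trans ?_ hc
    rw [hβN]
    have hb : 0 ≤ βW / (N : ℝ) ^ 2 := by positivity
    have h2 : 1 + 2 * Real.sqrt N * ε₁ ≤ 1 + 2 * S * ε₁ := by nlinarith
    have h3 : 0 ≤ 1 + 2 * Real.sqrt N * ε₁ := by positivity
    calc K * Real.exp ε₀ * (1 + 2 * Real.sqrt N * ε₁) * (βW / (N : ℝ) ^ 2)
        ≤ Kb * E * (1 + 2 * Real.sqrt N * ε₁) * (βW / (N : ℝ) ^ 2) := by gcongr
      _ ≤ Kb * E * (1 + 2 * S * ε₁) * (βW / (N : ℝ) ^ 2) := by gcongr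
  have hlam' : Real.sqrt N * ε₁ ≤ lam := le_trans (mul_le_mul_of_nonneg_right hS hε₁) hlam
  have hθ' : θ = (2 * ((4 : ℕ) : ℝ) - 2) * c + lam := by rw [hθ]; push_cast; ring
  have hρ' : ρ = gaugeR 4 c + (lam + θ ^ Kn * (4 * ((4 : ℕ) : ℝ) * lam)) / (1 - θ) := by rw [hρ]; push_cast; ring
  have h := torusClusteringOnBallUpTo_of_robustStar (d := 4) (N := N) (by norm_num) hN1 r Kn hK0 hR' hmod hε₁ hc'
    hlam' hθ' hθ1 hcd hρ' hρ1
  refine ⟨_, _, ?_, h⟩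
  have h1 : 0 < 1 - ρ := by linarith
  have hden : 0 < 2 * (2 * ρ * ((2 * 4 : ℕ) : ℝ) + 1) := by push_cast; nlinarith
  positivity

/-- **SCHEMA, `SU(N)` (`N ≥ 2`), `d = 3`, HYPOTHESIS-FREE**: Y4's receiving currency `YM3IR.ClusterDomainClustering`
on the whole tier-1 ball up to `β_W/N` through the ROBUST STAR DOOR on p2's eigen modulus at radius `R = 4β_W/N² < 1/2`
(door `8c² + 6c < 1`, `θ = 4c + λ`), plus the torus form. [folklore] -/
theorem suN_clusterDomainClustering_dim3_star_eigen (Kn : ℕ) {N : ℕ} (hN : 2 ≤ N) {βW ε₀ ε₁ c lam E S Kb : ℝ}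
    (hβ0 : 0 < βW) (hR : βW / (N : ℝ) ^ 2 * 4 < 1 / 2) (hε₁ : 0 ≤ ε₁) (hE : Real.exp ε₀ ≤ E)
    (hS : Real.sqrt N ≤ S) (hKb : (N : ℝ) ^ 2 / ((N : ℝ) ^ 2 - 1) * ((1 / 2 + 2 * (βW / (N : ℝ) ^ 2 * 4)) /
      (1 / 2 - βW / (N : ℝ) ^ 2 * 4)) ≤ Kb)
    (hc : Kb * E * (1 + 2 * S * ε₁) * (βW / (N : ℝ) ^ 2) ≤ c) (hlam : S * ε₁ ≤ lam) (hθ1 : 4 * c + lam < 1)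
    (hcd : doorPoly 3 c < 1) (hρ1 : gaugeR 3 c + (lam + (4 * c + lam) ^ Kn * (12 * lam)) / (1 - (4 * c + lam)) < 1)
    (r : ℕ) : ∃ m : ℝ, 0 < m ∧
      YM3IR.ClusterDomainClustering (G := SUN N)
        ⟨fundamentalRep (Fin N), βW / N, fun _ _ W => W ∈ ClusterDomainFR ε₀ ε₁ r⟩ suFrobDist m ∧
      ∃ A : ℝ, TorusClusteringOnBallUpTo N 3 (βW / N) ε₀ ε₁ r A m := by
  have hN1 : 1 ≤ N := by omega
  have hNpos : (0 : ℝ) < N := by exact_mod_cast (show 0 < N by omega)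
  have hN2 : (2 : ℝ) ≤ N := by exact_mod_cast hN
  set R : ℝ := βW / (N : ℝ) ^ 2 * 4 with hRdef
  have hR0 : 0 ≤ R := by positivity
  set K : ℝ := (N : ℝ) ^ 2 / ((N : ℝ) ^ 2 - 1) * ((1 / 2 + 2 * R) / (1 / 2 - R)) with hKdef
  have hmod : OneLinkKRModulus N R K := OneLinkEigen.oneLinkKRModulus_eigen hN hR
  have hK0 : 0 ≤ K := by
    have h1 : (0 : ℝ) < (N : ℝ) ^ 2 - 1 := by nlinarith
    have h2 : (0 : ℝ) < 1 / 2 - R := by linarith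
    positivity
  have hS0 : 0 ≤ S := (Real.sqrt_nonneg _).trans hS
  have hE0 : 0 ≤ E := (Real.exp_pos _).le.trans hE
  have hKb0 : 0 ≤ Kb := hK0.trans hKb
  have hc0 : 0 ≤ c := le_trans (by positivity) hc
  have hlam0 : 0 ≤ lam := le_trans (by positivity) hlam
  set θ : ℝ := 4 * c + lam with hθ
  set ρ : ℝ := gaugeR 3 c + (lam + θ ^ Kn * (12 * lam)) / (1 - θ) with hρ
  have hθ0 : 0 ≤ θ := by positivity
  have hgR := gaugeR_lt_one_of_door (d := 3) (by norm_num) hc0 hcd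
  have hρ0 : 0 ≤ ρ := by
    have : 0 ≤ θ ^ Kn := pow_nonneg hθ0 Kn
    have h1 : 0 < 1 - θ := by linarith
    rw [hρ]; exact add_nonneg hgR.1 (div_nonneg (by positivity) h1.le)
  have hβN : βW / (N : ℝ) / (N : ℝ) = βW / (N : ℝ) ^ 2 := by rw [div_div, sq]
  have hR' : βW / (N : ℝ) / (N : ℝ) * 4 ≤ R := by rw [hβN, hRdef]
  have hR'' : βW / (N : ℝ) / (N : ℝ) * (2 * (((3 : ℕ) : ℝ) - 1)) ≤ R := by rw [hβN, hRdef]; norm_num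
  have hc' : K * Real.exp ε₀ * (1 + 2 * Real.sqrt N * ε₁) * (βW / (N : ℝ) / (N : ℝ)) ≤ c := by
    refine le_trans ?_ hc
    rw [hβN]
    have hb : 0 ≤ βW / (N : ℝ) ^ 2 := by positivity
    have h2 : 1 + 2 * Real.sqrt N * ε₁ ≤ 1 + 2 * S * ε₁ := by nlinarith
    have h3 : 0 ≤ 1 + 2 * Real.sqrt N * ε₁ := by positivity
    calc K * Real.exp ε₀ * (1 + 2 * Real.sqrt N * ε₁) * (βW / (N : ℝ) ^ 2)
        ≤ Kb * E * (1 + 2 * Real.sqrt N * ε₁) * (βW / (N : ℝ) ^ 2) := by gcongr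
      _ ≤ Kb * E * (1 + 2 * S * ε₁) * (βW / (N : ℝ) ^ 2) := by gcongr
  have hlam' : Real.sqrt N * ε₁ ≤ lam := le_trans (mul_le_mul_of_nonneg_right hS hε₁) hlam
  have hθ' : θ = (2 * ((3 : ℕ) : ℝ) - 2) * c + lam := by rw [hθ]; push_cast; ring
  have hρ' : ρ = gaugeR 3 c + (lam + θ ^ Kn * (4 * ((3 : ℕ) : ℝ) * lam)) / (1 - θ) := by rw [hρ]; push_cast; ring
  have hm : 0 < (1 - ρ) ^ 2 / (2 * (2 * ρ * ((2 * 3 : ℕ) : ℝ) + 1)) / ((max r 1 + 2 : ℕ) : ℝ) := by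
    have h1 : 0 < 1 - ρ := by linarith
    have hden : 0 < 2 * (2 * ρ * ((2 * 3 : ℕ) : ℝ) + 1) := by push_cast; nlinarith
    positivity
  refine ⟨_, hm, clusterDomainClustering_dim3_of_robustStar (N := N) hN1 r Kn hK0 hR' hmod hε₁ hc' hlam' hθ hθ1
    hcd hρ hρ1, _, torusClusteringOnBallUpTo_of_robustStar (d := 3) (N := N) (by norm_num) hN1 r Kn hK0 hR'' hmod hε₁
      hc' hlam' hθ' hθ1 hcd hρ' hρ1⟩

/-! ### The `SU(3)` rows, `d = 4` (hypothesis-free torus clustering on the whole tier-1 ball) -/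

/-- **ROW `(β_W, ε) = (1 / 8, 37 / 250)`, `SU(3)`, `d = 4`, ROBUST STAR DOOR on the eigen modulus
(`R = 1 / 12`, `K₁ = 9 / 5`; certificate `c = 10169 / 200000`, `λ = 51269 / 200000`, `ρ ≈ 0.9950`):
every member of `ClusterDomainFR (37 / 125) (37 / 250) r` clusters on every torus `(ℤ/L)⁴`, `L ≥ 3`, at every tree
coupling `0 ≤ β ≤ 1 / 24`; HYPOTHESIS-FREE (no H1/H2). [folklore] -/
theorem su3_torusClusteringOnBallUpTo_star_oneEighth (r : ℕ) :
    ∃ A m : ℝ, 0 < m ∧ TorusClusteringOnBallUpTo 3 4 (1 / 24) (37 / 125) (37 / 250) r A m := by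
  have e1 : (1 / 8 : ℝ) / ((3 : ℕ) : ℝ) = 1 / 24 := by norm_num
  have hS : Real.sqrt ((3 : ℕ) : ℝ) ≤ 1.73206 := by
    have : ((3 : ℕ) : ℝ) = 3 := by norm_num
    rw [this]; exact sqrt_three_le
  have h := suN_torusClusteringOnBallUpTo_star_eigen 20 (N := 3) (by norm_num) (βW := 1 / 8) (ε₀ := 37 / 125)
    (ε₁ := 37 / 250) (c := 10169 / 200000) (lam := 51269 / 200000) (E := 1344473 / 1000000) (S := 1.73206) (Kb := 9 / 5)
    (by norm_num) (by norm_num) (by norm_num) exp_le_37_125_star hS (by norm_num) (by norm_num) (by norm_num) (by norm_num)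
    (by unfold doorPoly; norm_num) (by unfold gaugeR Delta; norm_num) r
  rw [e1] at h
  exact h

/-- **ROW `(β_W, ε) = (1 / 6, 13 / 125)`, `SU(3)`, `d = 4`, ROBUST STAR DOOR on the eigen modulus
(`R = 1 / 9`, `K₁ = 117 / 56`; certificate `c = 64799 / 1000000`, `λ = 36027 / 200000`, `ρ ≈ 0.9965`):
every member of `ClusterDomainFR (26 / 125) (13 / 125) r` clusters on every torus `(ℤ/L)⁴`, `L ≥ 3`, at every tree
coupling `0 ≤ β ≤ 1 / 18`; HYPOTHESIS-FREE (no H1/H2). [folklore] -/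
theorem su3_torusClusteringOnBallUpTo_star_oneSixth (r : ℕ) :
    ∃ A m : ℝ, 0 < m ∧ TorusClusteringOnBallUpTo 3 4 (1 / 18) (26 / 125) (13 / 125) r A m := by
  have e1 : (1 / 6 : ℝ) / ((3 : ℕ) : ℝ) = 1 / 18 := by norm_num
  have hS : Real.sqrt ((3 : ℕ) : ℝ) ≤ 1.73206 := by
    have : ((3 : ℕ) : ℝ) = 3 := by norm_num
    rw [this]; exact sqrt_three_le
  have h := suN_torusClusteringOnBallUpTo_star_eigen 20 (N := 3) (by norm_num) (βW := 1 / 6) (ε₀ := 26 / 125)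
    (ε₁ := 13 / 125) (c := 64799 / 1000000) (lam := 36027 / 200000) (E := 615607 / 500000) (S := 1.73206) (Kb := 117 / 56)
    (by norm_num) (by norm_num) (by norm_num) exp_le_26_125_star3 hS (by norm_num) (by norm_num) (by norm_num) (by norm_num)
    (by unfold doorPoly; norm_num) (by unfold gaugeR Delta; norm_num) r
  rw [e1] at h
  exact h

/-- **ROW `(β_W, ε) = (1 / 5, 69 / 1000)`, `SU(3)`, `d = 4`, ROBUST STAR DOOR on the eigen modulus
(`R = 2 / 15`, `K₁ = 207 / 88`; certificate `c = 4647 / 62500`, `λ = 119513 / 1000000`, `ρ ≈ 0.9911`):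
every member of `ClusterDomainFR (69 / 500) (69 / 1000) r` clusters on every torus `(ℤ/L)⁴`, `L ≥ 3`, at every tree
coupling `0 ≤ β ≤ 1 / 15`; HYPOTHESIS-FREE (no H1/H2). [folklore] -/
theorem su3_torusClusteringOnBallUpTo_star_oneFifth (r : ℕ) :
    ∃ A m : ℝ, 0 < m ∧ TorusClusteringOnBallUpTo 3 4 (1 / 15) (69 / 500) (69 / 1000) r A m := by
  have e1 : (1 / 5 : ℝ) / ((3 : ℕ) : ℝ) = 1 / 15 := by norm_num
  have hS : Real.sqrt ((3 : ℕ) : ℝ) ≤ 1.73206 := by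
    have : ((3 : ℕ) : ℝ) = 3 := by norm_num
    rw [this]; exact sqrt_three_le
  have h := suN_torusClusteringOnBallUpTo_star_eigen 20 (N := 3) (by norm_num) (βW := 1 / 5) (ε₀ := 69 / 500)
    (ε₁ := 69 / 1000) (c := 4647 / 62500) (lam := 119513 / 1000000) (E := 143497 / 125000) (S := 1.73206) (Kb := 207 / 88)
    (by norm_num) (by norm_num) (by norm_num) exp_le_69_500_star3 hS (by norm_num) (by norm_num) (by norm_num) (by norm_num)
    (by unfold doorPoly; norm_num) (by unfold gaugeR Delta; norm_num) r
  rw [e1] at h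
  exact h

/-- **ROW `(β_W, ε) = (1 / 4, 19 / 1000)`, `SU(3)`, `d = 4`, ROBUST STAR DOOR on the eigen modulus
(`R = 1 / 6`, `K₁ = 45 / 16`; certificate `c = 86493 / 1000000`, `λ = 3291 / 100000`, `ρ ≈ 0.9991`):
every member of `ClusterDomainFR (19 / 500) (19 / 1000) r` clusters on every torus `(ℤ/L)⁴`, `L ≥ 3`, at every tree
coupling `0 ≤ β ≤ 1 / 12`; HYPOTHESIS-FREE (no H1/H2). [folklore] -/
theorem su3_torusClusteringOnBallUpTo_star_oneQuarter (r : ℕ) :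
    ∃ A m : ℝ, 0 < m ∧ TorusClusteringOnBallUpTo 3 4 (1 / 12) (19 / 500) (19 / 1000) r A m := by
  have e1 : (1 / 4 : ℝ) / ((3 : ℕ) : ℝ) = 1 / 12 := by norm_num
  have hS : Real.sqrt ((3 : ℕ) : ℝ) ≤ 1.73206 := by
    have : ((3 : ℕ) : ℝ) = 3 := by norm_num
    rw [this]; exact sqrt_three_le
  have h := suN_torusClusteringOnBallUpTo_star_eigen 20 (N := 3) (by norm_num) (βW := 1 / 4) (ε₀ := 19 / 500)
    (ε₁ := 19 / 1000) (c := 86493 / 1000000) (lam := 3291 / 100000) (E := 259683 / 250000) (S := 1.73206) (Kb := 45 / 16)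
    (by norm_num) (by norm_num) (by norm_num) exp_le_19_500_star3 hS (by norm_num) (by norm_num) (by norm_num) (by norm_num)
    (by unfold doorPoly; norm_num) (by unfold gaugeR Delta; norm_num) r
  rw [e1] at h
  exact h

/-! ### The `SU(3)` rows, `d = 3` (hypothesis-free Y4 receiving currency) -/

/-- **ROW `(β_W, ε) = (1 / 4, 53 / 500)`, `SU(3)`, `d = 3`, ROBUST STAR DOOR on the eigen modulus
(`R = 1 / 9`, `K₁ = 117 / 56`; certificate `c = 24521 / 250000`, `λ = 183599 / 1000000`, `ρ ≈ 0.9959`):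
Y4's `YM3IR.ClusterDomainClustering` on `ClusterDomainFR (53 / 250) (53 / 500) r` up to tree coupling `1 / 12`, plus
the torus form; HYPOTHESIS-FREE (no H1/H2). [folklore] -/
theorem su3_clusterDomainClustering_dim3_star_oneQuarter (r : ℕ) :
    ∃ m : ℝ, 0 < m ∧
      YM3IR.ClusterDomainClustering (G := SUN 3)
        ⟨fundamentalRep (Fin 3), 1 / 12, fun _ _ W => W ∈ ClusterDomainFR (53 / 250) (53 / 500) r⟩ suFrobDist m ∧
      ∃ A : ℝ, TorusClusteringOnBallUpTo 3 3 (1 / 12) (53 / 250) (53 / 500) r A m := by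
  have e1 : (1 / 4 : ℝ) / ((3 : ℕ) : ℝ) = 1 / 12 := by norm_num
  have hS : Real.sqrt ((3 : ℕ) : ℝ) ≤ 1.73206 := by
    have : ((3 : ℕ) : ℝ) = 3 := by norm_num
    rw [this]; exact sqrt_three_le
  have h := suN_clusterDomainClustering_dim3_star_eigen 20 (N := 3) (by norm_num) (βW := 1 / 4) (ε₀ := 53 / 250)
    (ε₁ := 53 / 500) (c := 24521 / 250000) (lam := 183599 / 1000000) (E := 1236149 / 1000000) (S := 1.73206) (Kb := 117 / 56)
    (by norm_num) (by norm_num) (by norm_num) exp_le_53_250_star3 hS (by norm_num) (by norm_num) (by norm_num) (by norm_num)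
    (by unfold doorPoly; norm_num) (by unfold gaugeR Delta; norm_num) r
  rw [e1] at h
  exact h

/-- **ROW `(β_W, ε) = (3 / 10, 9 / 125)`, `SU(3)`, `d = 3`, ROBUST STAR DOOR on the eigen modulus
(`R = 2 / 15`, `K₁ = 207 / 88`; certificate `c = 5657 / 50000`, `λ = 124709 / 1000000`, `ρ ≈ 0.9923`):
Y4's `YM3IR.ClusterDomainClustering` on `ClusterDomainFR (18 / 125) (9 / 125) r` up to tree coupling `1 / 10`, plus
the torus form; HYPOTHESIS-FREE (no H1/H2). [folklore] -/
theorem su3_clusterDomainClustering_dim3_star_threeTenths (r : ℕ) :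
    ∃ m : ℝ, 0 < m ∧
      YM3IR.ClusterDomainClustering (G := SUN 3)
        ⟨fundamentalRep (Fin 3), 1 / 10, fun _ _ W => W ∈ ClusterDomainFR (18 / 125) (9 / 125) r⟩ suFrobDist m ∧
      ∃ A : ℝ, TorusClusteringOnBallUpTo 3 3 (1 / 10) (18 / 125) (9 / 125) r A m := by
  have e1 : (3 / 10 : ℝ) / ((3 : ℕ) : ℝ) = 1 / 10 := by norm_num
  have hS : Real.sqrt ((3 : ℕ) : ℝ) ≤ 1.73206 := by
    have : ((3 : ℕ) : ℝ) = 3 := by norm_num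
    rw [this]; exact sqrt_three_le
  have h := suN_clusterDomainClustering_dim3_star_eigen 20 (N := 3) (by norm_num) (βW := 3 / 10) (ε₀ := 18 / 125)
    (ε₁ := 9 / 125) (c := 5657 / 50000) (lam := 124709 / 1000000) (E := 230977 / 200000) (S := 1.73206) (Kb := 207 / 88)
    (by norm_num) (by norm_num) (by norm_num) exp_le_18_125_star3 hS (by norm_num) (by norm_num) (by norm_num) (by norm_num)
    (by unfold doorPoly; norm_num) (by unfold gaugeR Delta; norm_num) r
  rw [e1] at h
  exact h

/-- **ROW `(β_W, ε) = (1 / 3, 1 / 20)`, `SU(3)`, `d = 3`, ROBUST STAR DOOR on the eigen modulus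
(`R = 4 / 27`, `K₁ = 387 / 152`; certificate `c = 122267 / 1000000`, `λ = 86603 / 1000000`, `ρ ≈ 0.9931`):
Y4's `YM3IR.ClusterDomainClustering` on `ClusterDomainFR (1 / 10) (1 / 20) r` up to tree coupling `1 / 9`, plus
the torus form; HYPOTHESIS-FREE (no H1/H2). [folklore] -/
theorem su3_clusterDomainClustering_dim3_star_oneThird (r : ℕ) :
    ∃ m : ℝ, 0 < m ∧
      YM3IR.ClusterDomainClustering (G := SUN 3)
        ⟨fundamentalRep (Fin 3), 1 / 9, fun _ _ W => W ∈ ClusterDomainFR (1 / 10) (1 / 20) r⟩ suFrobDist m ∧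
      ∃ A : ℝ, TorusClusteringOnBallUpTo 3 3 (1 / 9) (1 / 10) (1 / 20) r A m := by
  have e1 : (1 / 3 : ℝ) / ((3 : ℕ) : ℝ) = 1 / 9 := by norm_num
  have hS : Real.sqrt ((3 : ℕ) : ℝ) ≤ 1.73206 := by
    have : ((3 : ℕ) : ℝ) = 3 := by norm_num
    rw [this]; exact sqrt_three_le
  have h := suN_clusterDomainClustering_dim3_star_eigen 20 (N := 3) (by norm_num) (βW := 1 / 3) (ε₀ := 1 / 10)
    (ε₁ := 1 / 20) (c := 122267 / 1000000) (lam := 86603 / 1000000) (E := 1105171 / 1000000) (S := 1.73206) (Kb := 387 / 152)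
    (by norm_num) (by norm_num) (by norm_num) exp_le_1_10_star hS (by norm_num) (by norm_num) (by norm_num) (by norm_num)
    (by unfold doorPoly; norm_num) (by unfold gaugeR Delta; norm_num) r
  rw [e1] at h
  exact h

end Summit.Ventures.YMGap.RobustBall

end
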